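import Summits.ResolutionOfSingularities.ResolutionOfSingularities.Theorems.FrobeniusClosingSteerEventualMonomial
import Summits.ResolutionOfSingularities.ResolutionOfSingularities.Theorems.FrobeniusClosingSteerCore4RunTrichotomy
import Literature.AlgebraicGeometry.Resolution.ValuedFunctionFields
import HarnessLib

/-!
# Crux `Steer` (stmt-ResolutionOfSingularities-16345), line `switching_dichotomy` r22 §F (res-L0-w41-strat-1's
# ALTERNATIVE DECOMPOSITION `ss-monomial-cycles` of the (α) heart): piece **S1 `SSMonomialization`**, LITERALLY

OURS (campaign `res-hironaka`, rung L ★L-G4, slot W4.1, chain W4.1; unit `res-D-pv-010 AS res-L0-w41-stub-6`; Theses-free,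
definition-free helper for the holder res-L0-w41-lead-1's skeleton r22 §F and the chain planner res-L0-w41-plan-1; replaces
the role of no printed item; NOT a statement of the manuscript under review [claim: Hironaka2017, status: under-review];
AI-produced, which is weaker than expert review).

**Content.** res-L0-w41-strat-1's S1 (`line-ss-monomial-cycles.lean` c94e4ea68bbafa85, §F; GRANJA'S CRITERION in rank one:
along a STRONGLY SWITCHING quadratic sequence of a core datum with `O` of rank one, every non-zero element `h` of a member
`R M` is, at some later member `R M'`, an rsop-monomial times a unit) is — up to bookkeeping — the tree's E-1
`EventualMonomial.exists_monomial_of_not_hasProperCoarsening` (res-L0-w41-stub-4, `FrobeniusClosingSteerEventualMonomial.lean`,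
[HeinzerEtAl2015, Prop. 4.4 / Lemma 2.7]). This file supplies the bookkeeping and the LITERAL leaf:

* `ne_top_of_valuation_lt_one` — a valuation ring with a non-zero element of positive value is not `K`;
* `exists_monomialAt` — E-1 read with the binders the skeleton carries (`hreg`, `¬ dim ≤ 2` instead of `O ≠ ⊤`, via
  `exists_mem_centre_of_not_ringKrullDim_le_two`), conclusion in the shape of §F's `MonomialAt (R M') h`;
* `ssMonomialization` — S1 with `CoreDatum`, `StronglySwitching`, `IsFracOf`, `MonomialAt` UNFOLDED verbatim (the core-datum
  block is copied character-for-character from res-L0-w41-stub-2's certified literal piece M,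
  `FrobeniusClosingSteerSteeredMembersRegularLiteral.lean`), so that the holder's leaf is
  `theorem stub_ssMonomialization : SSMonomialization := SSMonomialization.ssMonomialization` by `exact`.

Only the regularity binder, the dimension binder `¬ dim ≤ 2` and the strong-switching hypothesis are used.
[cite: HeinzerEtAl2015, Prop. 4.4] [cite: HeinzerEtAl2015, Lemma 2.7] [folklore]
-/

-- `Summit.<S>.<S>.…` duplicates the summit name by design (single-problem summit).
set_option linter.dupNamespace false

open IsLocalRing
open Literature.AlgebraicGeometry.Resolution

namespace Summit.ResolutionOfSingularities.ResolutionOfSingularities.Theorems.SwitchingDichotomy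

namespace SSMonomialization

open Summit.ResolutionOfSingularities.ResolutionOfSingularities.Theorems.SteerRankThinness
  (HasProperCoarsening)

variable {k K : Type} [Field k] [Field K] [Algebra k K]

/-- A valuation subring of `K` containing a non-zero element of value `< 1` is not all of `K` (the inverse has
value `> 1`). [folklore] -/
theorem ne_top_of_valuation_lt_one (O : ValuationSubring K) {a : K} (ha0 : a ≠ 0) (hva : O.valuation a < 1) :
    O ≠ ⊤ := by
  -- adapted from the skeleton r20 `archSeq_and_defect_of_not_hasProperCoarsening` (res-L0-w41-lead-1)
  intro hO
  have hinv : O.valuation a⁻¹ ≤ 1 :=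
    (O.valuation_le_one_iff _).mpr (by rw [hO]; exact ValuationSubring.mem_top _)
  have h1 : O.valuation a * O.valuation a⁻¹ = 1 := by rw [← map_mul, mul_inv_cancel₀ ha0, map_one]
  have hlt : O.valuation a * O.valuation a⁻¹ < 1 * 1 :=
    mul_lt_mul_of_lt_of_le_of_nonneg_of_pos hva hinv zero_le zero_lt_one
  rw [h1, one_mul] at hlt
  exact lt_irrefl _ hlt

/-- **Eventual monomialization (E-1) in the skeleton's binders.** For a base `A₀ ⊆ O` regular at the centre of `O`,
with centre of dimension `≥ 3` (so `O ≠ K`), `O` without proper coarsening (rank one), and a quadratic sequence `R` of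
`(A₀)_{𝔪_O ∩ A₀}` along `O` that is strongly switching: every non-zero `h ∈ R M` is an rsop-monomial times a unit in
some `R M'`, `M ≤ M'`. [cite: HeinzerEtAl2015, Prop. 4.4] [cite: HeinzerEtAl2015, Lemma 2.7] -/
theorem exists_monomialAt (O : ValuationSubring K) (A₀ : Subalgebra k K) (h₀ : A₀.toSubring ≤ O.toSubring)
    (hreg : IsRegularLocalRing (Localization.AtPrime
      (Ideal.comap (Subring.inclusion h₀) (IsLocalRing.maximalIdeal O))))
    (hdim2 : ¬ ringKrullDim (Localization.AtPrime
      (Ideal.comap (Subring.inclusion h₀) (IsLocalRing.maximalIdeal O))) ≤ 2)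
    (hnc : ¬ HasProperCoarsening O)
    (R : ℕ → Subring K) (hR0 : R 0 = locAtCentre A₀.toSubring O)
    (hstep : ∀ i, IsQuadraticTransformAlong O (R i) (R (i + 1)))
    (hSS : ∀ x : K, x ∈ O → (∃ y ∈ A₀, ∃ z ∈ A₀, z ≠ 0 ∧ x = y / z) → ∃ i, x ∈ R i)
    (M : ℕ) (h : K) (hhR : h ∈ R M) (hh0 : h ≠ 0) :
    ∃ M', M ≤ M' ∧ ∃ (_ : IsLocalRing (R M')), ∃ (s : ℕ) (z : Fin s → R M'), IsRsopPart z ∧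
      ∃ (m : Fin s → ℕ) (u : R M'), IsUnit u ∧ h = (∏ l, ((z l : R M') : K) ^ m l) * (u : K) := by
  obtain ⟨a, -, ha0, hva⟩ := exists_mem_centre_of_not_ringKrullDim_le_two O A₀ h₀ hdim2
  have hO : O ≠ ⊤ := ne_top_of_valuation_lt_one O ha0 hva
  obtain ⟨N, hN, hloc, s, z, hz, e, u, hu, he⟩ :=
    EventualMonomial.exists_monomial_of_not_hasProperCoarsening O hO hnc A₀ h₀ hreg R hR0 hstep hSS M h hhR hh0
  exact ⟨N, hN, hloc, s, z, hz, e, u, hu, he⟩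

/-- **S1 `SSMonomialization`, LITERALLY** (res-L0-w41-strat-1's §F, skeleton r22; `CoreDatum`, `StronglySwitching`,
`IsFracOf`, `MonomialAt` unfolded verbatim): along a strongly-switching quadratic sequence of a core datum with `O` of
rank one (no proper coarsening), every non-zero element of a member `R M` becomes an rsop-monomial times a unit in some
later member `R M'`. Proof: `exists_monomialAt` with the regularity and dimension binders of the core datum and the
strong-switching hypothesis instantiated at `R`. [cite: HeinzerEtAl2015, Prop. 4.4] [cite: HeinzerEtAl2015, Lemma 2.7] -/
theorem ssMonomialization :
    ∀ p : ℕ, p.Prime → p ≠ 2 → ∀ n : ℕ, 4 ≤ n →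
    ∀ (k K : Type) [Field k] [CharP k p] [PerfectField k] [Field K] [Algebra k K]
    (O : ValuationSubring K) (A₀ : Subalgebra k K) (h₀ : A₀.toSubring ≤ O.toSubring) (t : K),
    (A₀.FG ∧ ∃ htp : t ^ p ∈ A₀, IsFractionRing (Algebra.adjoin k (insert t (A₀ : Set K))) K ∧
      IsRegularLocalRing (Localization.AtPrime
        (Ideal.comap (Subring.inclusion h₀) (IsLocalRing.maximalIdeal O))) ∧
      (Ideal.comap (Subring.inclusion h₀) (IsLocalRing.maximalIdeal O)).IsMaximal ∧
      (∀ x ∈ O, ∃ f : Polynomial k, f ≠ 0 ∧ Polynomial.aeval x f ∈ O.nonunits) ∧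
      ¬ ringKrullDim (Localization.AtPrime
        (Ideal.comap (Subring.inclusion h₀) (IsLocalRing.maximalIdeal O))) ≤ 2 ∧
      ¬ IsAbhyankarPlace O (algebraMap k K).fieldRange ⊤ ∧
      ¬ (∃ F₀ : Subfield K, (algebraMap k K).fieldRange ≤ F₀ ∧ FGOver (algebraMap k K).fieldRange F₀ ∧
          IsAbhyankarPlace O (algebraMap k K).fieldRange F₀ ∧
          ∀ x w : K, w ≠ 0 → ∃ a ∈ F₀, O.valuation (x - a) < O.valuation w) ∧
      ¬ (∃ π : K, π ≠ 0 ∧ O.valuation π < 1 ∧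
          ∀ z : K, z ≠ 0 → ∃ n : ℤ, O.valuation z = O.valuation π ^ n) ∧
      (∀ δ : Derivation ℤ (Localization.AtPrime (Ideal.comap (Subring.inclusion h₀)
          (IsLocalRing.maximalIdeal O))) (Localization.AtPrime (Ideal.comap (Subring.inclusion h₀)
          (IsLocalRing.maximalIdeal O))),
        ¬ IsUnit (δ (algebraMap A₀.toSubring (Localization.AtPrime (Ideal.comap (Subring.inclusion h₀)
          (IsLocalRing.maximalIdeal O))) ⟨t ^ p, htp⟩))) ∧
      (∀ c : Localization.AtPrime (Ideal.comap (Subring.inclusion h₀) (IsLocalRing.maximalIdeal O)),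
        algebraMap A₀.toSubring (Localization.AtPrime (Ideal.comap (Subring.inclusion h₀)
          (IsLocalRing.maximalIdeal O))) ⟨t ^ p, htp⟩ ≠ c ^ p) ∧
      Algebra.trdeg k K = (n : Cardinal) ∧
      ¬ ((∀ R : ℕ → Subring K, R 0 = locAtCentre A₀.toSubring O →
            (∀ i, IsQuadraticTransformAlong O (R i) (R (i + 1))) →
            ∀ x : K, x ∈ O → (∃ y ∈ A₀, ∃ z ∈ A₀, z ≠ 0 ∧ x = y / z) → ∃ i, x ∈ R i) ∧
         (∀ R : ℕ → Subring K, R 0 = locAtCentre A₀.toSubring O →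
            (∀ i, IsQuadraticTransformAlong O (R i) (R (i + 1))) →
            ∀ y : K, (∃ y' ∈ A₀, ∃ z ∈ A₀, z ≠ 0 ∧ y = y' / z) → y ≠ 0 → O.valuation y < 1 →
              ∃ (i : ℕ) (_ : IsLocalRing (R i)) (z : Fin 1 → R i), IsRsopPart z ∧
                ∃ n : ℕ, O.valuation ((z 0 : R i) : K) ^ n < O.valuation y) ∧
         ¬ (∀ g : K, (∃ y ∈ A₀, ∃ z ∈ A₀, z ≠ 0 ∧ g = y / z) →
            ∃ w : K, (∃ y ∈ A₀, ∃ z ∈ A₀, z ≠ 0 ∧ w = y / z) ∧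
              O.valuation (t ^ p - g ^ p) = O.valuation (w ^ p)))) →
    (∀ R : ℕ → Subring K, R 0 = locAtCentre A₀.toSubring O →
      (∀ i, IsQuadraticTransformAlong O (R i) (R (i + 1))) →
      ∀ x : K, x ∈ O → (∃ y ∈ A₀, ∃ z ∈ A₀, z ≠ 0 ∧ x = y / z) → ∃ i, x ∈ R i) →
    ¬ HasProperCoarsening O →
    ∀ R : ℕ → Subring K, R 0 = locAtCentre A₀.toSubring O →
      (∀ i, IsQuadraticTransformAlong O (R i) (R (i + 1))) →
      ∀ (M : ℕ) (h : K), h ∈ R M → h ≠ 0 →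
        ∃ M', M ≤ M' ∧ ∃ (_ : IsLocalRing (R M')),
          ∃ (s : ℕ) (z : Fin s → R M'), IsRsopPart z ∧ ∃ (m : Fin s → ℕ) (u : R M'), IsUnit u ∧
            h = (∏ l, ((z l : R M') : K) ^ m l) * (u : K) := by
  intro p _ _ n _ k K _ _ _ _ _ O A₀ h₀ t core hss hnc R hR0 hstep M h hhR hh0
  obtain ⟨-, -, -, hreg, -, -, hdim2, -⟩ := core
  exact exists_monomialAt O A₀ h₀ hreg hdim2 hnc R hR0 hstep (hss R hR0 hstep) M h hhR hh0

end SSMonomialization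

end Summit.ResolutionOfSingularities.ResolutionOfSingularities.Theorems.SwitchingDichotomy
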